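import Summits.BirchSwinnertonDyer.Rank1Residual.Supersingular.JetchevIndexRoute
import Summits.BirchSwinnertonDyer.Rank1Residual.Supersingular.SurjSerreCertificateShape
import Summits.BirchSwinnertonDyer.Rank1Residual.Additive.IntModelTamagawaCertificateLocal
import Summits.BirchSwinnertonDyer.Rank1Residual.X11b.ChaPairsMinimality
import Summits.BirchSwinnertonDyer.Rank1Residual.X11b.CertificateCheckBridge
import Summits.BirchSwinnertonDyer.Rank1Residual.X11b.KrausMinimalityGeneralTwo
import Summits.BirchSwinnertonDyer.BirchSwinnertonDyer.Theorems.Rank1ResidualX11RankOneMinimality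
import Summits.BirchSwinnertonDyer.BirchSwinnertonDyer.Theorems.Rank1ResidualIntModelReduction
import Literature.NumberTheory.EllipticCurves.OrdinaryPrimesProofs
import HarnessLib

/-!
# BSD rank-≤1, LITERAL row D1 (BCS25 composite flag; cell `bsd-jet`, T1 stratum «D1-IDX»): the KIT of the
# per-pair JETCHEV TAMAGAWA-CERTIFICATE records at a GOOD prime `p ≥ 5` — `BSD(E,p)` for a literal integer
# model from kernel-decidable model checks, good reduction at `p`, THREE Serre witnesses (`ρ̄_{E,p}` onto),
# ONE Tate-algorithm certificate (`c_q` in the kernel), the published named facts and the two-engine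
# Heegner-index line `ord_p [E(K):ℤy_K] ≤ w`

HONEST FRAMING (programme `BSD-LIT2PART-PROGRAMME-v1.md` §HONESTY, verbatim): «no tranche here proves
BSD; ARM L moves the LITERAL column of an r ≤ 1 census into the kernel-proved-modulo-named-print
column; ARM P changes what «named print» is worth. The residue (4.31 %) and every SUMMIT-BEARING rung
(S0–S3) stay theorem-bound and are staffed by the 22 routes, not by this programme.» This file is a
TOOL: theorems only (no definition, no named fact, no `sorry`); PER PAIR; nothing is booked here;
nothing about any particular curve is asserted. Cell `bsd-jet` (run/shared/lean/pub/bsd-jet/), seat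
`bsd-jet-ty` (typer), gen 2; stratum «D1-IDX» (lead ruling 2026-08-26T17:16:34Z; road card
`pilot/d1/ROAD-D1-PER-PAIR-INDEX.md` of seat `bsd-litref-bcs25-ty`).

WHAT THIS FILE IS — the literal-model front end of the FLAG-FREE per-pair consumer
`Supersingular.bsdp_of_jetchevTamagawaCertificate` (`Supersingular/JetchevIndexRoute.lean` §0, generic —
NOT restricted to supersingular `p`): `BSD(E,p)` from Jetchev 2008 Cor. 1.5 (`hJ`, tree named fact
`Jetchev2008.cor15_padicValNat_card_primaryComponent_sha_le`, PUBLISHED, Compos. Math. 144 (2008); its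
Hypothesis (∗) is `p ∤ N`, `ρ̄_{E,p}` surjective — both DISCHARGED here, so the sharpening is used INSIDE
print), Kolyvagin's finiteness `hKo : kolyvagin N W K` (Kolyvagin 1990 Thm. A / Gross 1991 Thm. 1.3) and
GZK `hGZK` (bsd.S17). It is the D1 analogue of this seat's `JET/IndexTamagawaRecordsKit.lean`
(`JET.bsdp_of_jetIndexRow_tam`, gen 0: the FLAGGED Miller–Cha consumer at `p ∥ N`) and of x11c's
`X4.bsdp_prime_of_kolyvaginIndex_of_serreCounts` (`X4/KolyvaginIndexRecordsKitOddPrime.lean`: the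
UNSHARPENED Kolyvagin line `p ∤ [E(K):ℤP]`, which serves every D1 row whose index is prime to `p` with
NO new kit). A D1 pair `(E, p)` has `p ≥ 5` of GOOD (ordinary) reduction, `E` non-semistable, `ρ̄_{E,p}`
surjective; when `p ∣ c_q(E)` at exactly ONE bad prime `q` (split `I_n`, `p ∣ n`), Gross–Zagier forces
`p ∣ [E(K):ℤy_K]` in every Heegner field and only the Tamagawa-sharpened line
`ord_p [E(K):ℤy_K] ≤ ord_p c_q` can certify `Ш(E)[p] = 0` — that is the row shape this kit lands.
For a literal model the consumer's hypotheses are discharged IN THE KERNEL: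
  * `IsElliptic` / `IsGloballyMinimal` from `Δ ≠ 0` and the bounded Kraus criterion
    (`X11RankOne.isGloballyMinimal_of_krausCriterion_bounded`), or supplied explicitly (`_min` form: any tree
    criterion, e.g. prover B's factored five-pattern `Supersingular.isGloballyMinimal_of_krausCriterion₃_factored`);
  * `p ∤ N` for the level `N` of the Heegner datum from GOOD REDUCTION AT `p`, read off the minimal model
    as `p ∤ Δ` (`WeierstrassCurve.hasGoodReductionAtPrime_of_not_dvd`, Silverman VII.1 Rem. 1.1 / VII.5
    Prop. 5.1 (a)) and the tree theorem `Supersingular.not_dvd_level_of_isHeegnerPoint_of_good` (the newform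
    of the parametrisation datum has level with the prime support of the conductor);
  * `ρ̄_{E,p}` SURJECTIVE (`p ≥ 5`) from THREE Frobenius elements by Serre 1972 Prop. 19 — good odd
    primes `ℓ₁, ℓ₂, ℓ₃ ≠ p` with (i) `a₁² − 4ℓ₁ = r²` a non-zero square, `a₁ ≠ 0`; (ii) `a₂² − 4ℓ₂` a
    non-square by Euler's criterion `d^{(p−1)/2} = −1`, `a₂ ≠ 0`; (iii) `a₃² = uℓ₃`, `u ∉ {0,1,2,4}`,
    `u² − 3u + 1 ≠ 0` (mod `p`), `aᵢ = ℓᵢ + 1 − #Ẽ(𝔽_ℓᵢ)` from the schema's kernel point counts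
    `countPoints` — packaged by prover B's `Supersingular.surj_of_ainvs_of_serreWitnesses`
    (`SurjSerreCertificateShape.lean`; x11c's `IntModel.hasSurjectiveModNGaloisRep_of_intModel_of_serreWitnesses`);
  * the TAMAGAWA HALF of the certificate: `c_q(W/ℚ_q) = c` from ONE `decide`-able stage-1 certificate
    `T : TamLocal` of the rank-2 observatory (Tate's algorithm; split `Iₙ` ⇒ `c = n`; singleton value set)
    through n1011-p03's bridge `Additive.IntModelTam.localTamagawaNumber_padic_eq_of_intModel_of_tamLocal`
    (p260470; transport theorem `localTamagawaNumber_padic_eq_holds`, NO named fact), and `w ≤ ord_p c`.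
Every numeric hypothesis is a `decide` goal for a literal record; every other hypothesis is a DISPLAYED
binder, exactly as in every Heegner-index record of the tree: the published facts `hJ`, `hKo`, `hGZK`;
the Heegner datum (`K` imaginary quadratic with `d_K ≠ −3` and the Heegner hypothesis for the level `N`,
`P = y_K` of infinite order); the OPTIMAL-PARAMETRISATION datum `hopt` (`∃ Dt, Λ_W ⊇ c·Λ_f` with equality —
Cremona optimality of the class representative, of record); `q ∣ N`; the pure INDEX LINE
`hv : ord_p [E(K):ℤP] ≤ w` (two engines: the Heegner index by the Gross–Zagier value formula in Miller's
normalisation, Miller 2011 Thm. 4.1 / Cor. 4.8 — T1's eng-1 `jetA.gp` / eng-2 `jetB.py` — NEVER a kernel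
computation); `r_an ≤ 1`; `#Ш_an = s` with `ord_p s = 0`. What such a record is worth (tier) is the
referee's ruling, not this file's (ROUND-on-OFFER in the R302 currency: per-pair kernel theorem by name +
PUB facts + one two-engine certificate line).

* `bsdp_of_d1IndexRow_tam_min` — global minimality supplied as a hypothesis (any tree criterion; the records use
  prover B's complete five-pattern factored Kraus criterion `Supersingular.isGloballyMinimal_of_krausCriterion₃_factored`,
  which has no size guard and no uncovered minimal Cremona model on the census).
* `bsdp_of_d1IndexRow_tam` — bounded-Kraus form (models with `|Δ| < 512¹²`; x11c's bounded criterion).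
* `bsdp_of_d1IndexRow_unit_min` / `_unit` — the UNIT index line `p ∤ [E(K):ℤy_K]` (the D1 rows
  whose index is prime to `p`): Kolyvagin 1990 as printed by McCallum 1991 §1 (`hB : Kolyvagin1990_padicValNat_card_sha_le
  N W K`, PUBLISHED, no reduction hypothesis at `p`; consumer `Typed.bsdp_of_kolyvagin_of_not_dvd_index`), same three
  Serre witnesses, NO Tamagawa certificate, NO optimality datum — x11c's `X4.bsdp_prime_of_kolyvaginIndex_of_serreCounts`
  road in prover B's explicit-witness format, so that both D1 row shapes share one generator.

References: D. Jetchev, *Global divisibility of Heegner points and Tamagawa numbers*, Compos. Math. 144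
(2008) 811–826, Hypothesis (∗), Cor. 1.5 [Jetchev2008]; V. A. Kolyvagin, *Euler systems* (1990) Thm. A
[KolyvaginEulerSystems1990]; B. H. Gross, LMS LN 153 (1991) Thm. 1.3 [GrossLMS1991]; J.-P. Serre, Invent.
Math. 15 (1972) §2.8 Prop. 19, §5.2 (iii) [Serre1972]; K. Ireland, M. Rosen, GTM 84 (1990) Prop. 5.1.2
[IrelandRosen1990]; W. G. McCallum, LMS LN 153 (1991) §1 Theorem, p. 296 [McCallumLMS1991]; R. L. Miller, LMS J. Comput. Math. 14 (2011) Def. 1.1, Thm. 4.1, Cor. 4.8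
[Miller2011LMS]; J. H. Silverman, *AEC* (2009) VII.1 Rem. 1.1, VII.5 Prop. 5.1, VIII.8 [SilvermanAEC2009];
J. H. Silverman, *Advanced Topics* (1994) IV.9.4 [SilvermanATAEC1994]; A. Kraus, Acta Arith. 54 (1989)
Prop. 1–2 [Kraus1989]; F. Diamond, J. Shurman, GTM 228, Prop. 5.8.5 / (8.44) [DiamondShurman2005].
-/

set_option autoImplicit false

noncomputable section

open scoped Classical

open WeierstrassCurve Literature.NumberTheory.EllipticCurves
  Literature.NumberTheory.EllipticCurves.ModularForms
  Literature.NumberTheory.EllipticCurves.Rank1Residual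
  Literature.NumberTheory.EllipticCurves.Rank1Residual.Typed
  Literature.NumberTheory.EllipticCurves.Rank1Residual.X11RankOneCertificates
  Summit.BirchSwinnertonDyer.BirchSwinnertonDyer.Rank1Residual
  Summit.BirchSwinnertonDyer.BirchSwinnertonDyer.Rank1Residual.IntModel
  Summit.BirchSwinnertonDyer.BirchSwinnertonDyer.Rank1Residual.X11RankOne
  Summit.BirchSwinnertonDyer.BirchSwinnertonDyer.Rank2Observatory.Tam

namespace Summit.BirchSwinnertonDyer.Rank1Residual.JET

/-- **`BSD(E,p)` at a GOOD prime `p ≥ 5` for a literal integer model from the two-engine HEEGNER-INDEX line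
`ord_p [E(K):ℤy_K] ≤ w` through Jetchev 2008 Cor. 1.5 (flag-free, inside Hypothesis (∗)), with surjectivity
of `ρ̄_{E,p}`, good reduction at `p` and the Tamagawa exponent `w ≤ ord_p c_q(E)` CHECKED IN THE KERNEL —
minimality supplied.** Inputs: (kernel, `decide` goals for a record) `hmin` global minimality of the literal
model (any tree criterion); `p ∤ Δ` (good reduction at `p` ⇒ `p ∤ N` for the level of the Heegner datum);
THREE Serre witnesses `ℓ₁, ℓ₂, ℓ₃` (odd good primes `≠ p`, schema counts `countPoints [a] ℓᵢ = nᵢ`,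
`aᵢ = ℓᵢ + 1 − nᵢ`; (i) `a₁² − 4ℓ₁ = r²  ≠ 0`, `a₁ ≠ 0`; (ii) `(a₂² − 4ℓ₂)^{(p−1)/2} = −1`, `a₂ ≠ 0`;
(iii) `a₃² = uℓ₃`, `u ∉ {0,1,2,4}`, `u² − 3u + 1 ≠ 0`, in `ZMod p` ⇒ `ρ̄_{E,p}` onto, Serre Prop. 19);
ONE stage-1 Tamagawa certificate `T : TamLocal` at `q = T.p` with `T.check = true` and singleton value set
`[c]` (⇒ `c_q(W/ℚ_q) = c`) and `w ≤ ord_p c`; (binders, displayed) Jetchev 2008 Cor. 1.5 `hJ` (PUBLISHED),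
Kolyvagin's finiteness `hKo`, GZK `hGZK`, the Heegner datum `K` (`d_K ≠ −3`, Heegner hypothesis for `N`),
the optimal-parametrisation datum `hopt`, `P = y_K` of infinite order, `q ∣ N`, the INDEX LINE
`hv : ord_p [E(K):ℤP] ≤ w`, `r_an ≤ 1`, `#Ш_an = s` with `ord_p s = 0`. Output:
`Supersingular.bsdp_of_jetchevTamagawaCertificate`. Per pair; no class statement; nothing about any
particular curve is asserted. [cite: Jetchev2008, Hypothesis (*) and Cor. 1.5 (p. 3)]
[cite: Serre1972, §2.8 Prop. 19 and §5.2 (iii)] [cite: IrelandRosen1990, Prop. 5.1.2]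
[cite: SilvermanAEC2009, VII.1 Remark 1.1 and VII.5 Prop. 5.1(a)] [cite: SilvermanATAEC1994, IV.9.4 and Cor. IV.9.2(d)]
[cite: GrossLMS1991, §1 Thm. 1.3] [cite: Miller2011LMS, §1 Def. 1.1, Thm. 4.1 and Cor. 4.8] -/
theorem bsdp_of_d1IndexRow_tam_min (p : ℕ) (hp : p.Prime) (hp5 : 5 ≤ p) (a1 a2 a3 a4 a6 : ℤ)
    (hmin : (⟨a1, a2, a3, a4, a6⟩ : WeierstrassCurve ℚ).IsGloballyMinimal)
    (hpΔ : ¬ (p : ℤ) ∣ discOf [a1, a2, a3, a4, a6])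
    (ℓ₁ ℓ₂ ℓ₃ : ℕ) (hℓ₁ : ℓ₁.Prime) (hℓ₂ : ℓ₂.Prime) (hℓ₃ : ℓ₃.Prime)
    (h2₁ : ℓ₁ ≠ 2) (h2₂ : ℓ₂ ≠ 2) (h2₃ : ℓ₃ ≠ 2) (hne₁ : ℓ₁ ≠ p) (hne₂ : ℓ₂ ≠ p) (hne₃ : ℓ₃ ≠ p)
    (hΔ₁ : ¬ (ℓ₁ : ℤ) ∣ discOf [a1, a2, a3, a4, a6]) (hΔ₂ : ¬ (ℓ₂ : ℤ) ∣ discOf [a1, a2, a3, a4, a6])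
    (hΔ₃ : ¬ (ℓ₃ : ℤ) ∣ discOf [a1, a2, a3, a4, a6])
    {n₁ n₂ n₃ : ℕ} (hc₁ : countPoints [a1, a2, a3, a4, a6] ℓ₁ = n₁)
    (hc₂ : countPoints [a1, a2, a3, a4, a6] ℓ₂ = n₂) (hc₃ : countPoints [a1, a2, a3, a4, a6] ℓ₃ = n₃)
    (r u : ZMod p)
    (hi : (((ℓ₁ : ℤ) + 1 - n₁ : ℤ) : ZMod p) ^ 2 - 4 * ℓ₁ = r * r ∧
      (((ℓ₁ : ℤ) + 1 - n₁ : ℤ) : ZMod p) ^ 2 - 4 * ℓ₁ ≠ 0 ∧ (((ℓ₁ : ℤ) + 1 - n₁ : ℤ) : ZMod p) ≠ 0)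
    (hii : ((((ℓ₂ : ℤ) + 1 - n₂ : ℤ) : ZMod p) ^ 2 - 4 * ℓ₂) ^ (p / 2) = -1 ∧
      (((ℓ₂ : ℤ) + 1 - n₂ : ℤ) : ZMod p) ≠ 0)
    (hiii : (((ℓ₃ : ℤ) + 1 - n₃ : ℤ) : ZMod p) ^ 2 = u * ℓ₃ ∧
      u ≠ 0 ∧ u ≠ 1 ∧ u ≠ 2 ∧ u ≠ 4 ∧ u ^ 2 - 3 * u + 1 ≠ 0)
    (q : ℕ) (T : TamLocal) (hTq : T.p = q) (hT : T.check ⟨a1, a2, a3, a4, a6⟩ = true)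
    {c : ℕ} (hvals : T.vals = [c]) {w : ℕ} (hw : w ≤ padicValNat p c)
    (hJ : Jetchev2008.cor15_padicValNat_card_primaryComponent_sha_le)
    (hGZK : rank_eq_analyticRank_of_analyticRank_le_one)
    (W : WeierstrassCurve ℚ) (hW : W = ⟨a1, a2, a3, a4, a6⟩)
    {N : ℕ} [NeZero N] {K : Type} [Field K] [NumberField K] (hKo : kolyvagin N W K)
    (hK : IsImaginaryQuadratic K) (hD3 : NumberField.discr K ≠ -3)
    (hH : SatisfiesHeegnerHypothesis N K)
    (hopt : ∃ Dt : ModularParametrizationData W N,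
      ∀ z ∈ Dt.L.lattice, ∃ w ∈ periodLattice Dt.f, z = (Dt.c : ℂ) * w)
    {P : (W.baseChange K).toAffine.Point} (hP : IsHeegnerPoint N W K P) (hnt : ¬ IsOfFinAddOrder P)
    (hqN : q ∣ N) (hv : padicValNat p (AddSubgroup.zmultiples P).index ≤ w)
    (hr : W.analyticRank ≤ 1) {s : ℚ} (hs : shaAn W = (s : ℂ)) (hvs : padicValRat p s = 0) :
    BSDp W p := by
  subst hW
  have h0 : discOf [a1, a2, a3, a4, a6] ≠ 0 := fun h ↦ hΔ₁ (by rw [h]; exact dvd_zero _)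
  haveI hE : (⟨a1, a2, a3, a4, a6⟩ : WeierstrassCurve ℚ).IsElliptic :=
    X11b.isElliptic_of_discOf_ne_zero a1 a2 a3 a4 a6 h0
  haveI := hmin
  haveI : Fact (Nat.Prime p) := ⟨hp⟩
  haveI : Fact (Nat.Prime q) := ⟨hTq ▸ (TamLocal.check_common hT).1⟩
  have hp2 : p ≠ 2 := by omega
  have hI0 : integralModelInt (⟨a1, a2, a3, a4, a6⟩ : WeierstrassCurve ℚ) = ⟨a1, a2, a3, a4, a6⟩ :=
    integralModelInt_eq_of_map_eq _ (map_mk_int a1 a2 a3 a4 a6)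
  -- good reduction at `p` (minimal model, `p ∤ Δ`), hence `p ∤ N` for the level of the Heegner datum
  have hgood : (⟨a1, a2, a3, a4, a6⟩ : WeierstrassCurve ℚ).HasGoodReductionAtPrime p :=
    hasGoodReductionAtPrime_of_not_dvd _ p (by rw [minimalDiscriminantInt_eq hI0, intCurve_Δ]; exact hpΔ)
  have hpN : ¬ p ∣ N := Supersingular.not_dvd_level_of_isHeegnerPoint_of_good _ p hP hgood
  -- `ρ̄_{E,p}` surjective from the three Serre witnesses (Serre 1972 Prop. 19)
  have hρ : (⟨a1, a2, a3, a4, a6⟩ : WeierstrassCurve ℚ).HasSurjectiveModNGaloisRep p :=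
    Supersingular.surj_of_ainvs_of_serreWitnesses a1 a2 a3 a4 a6 p hp5 hmin ℓ₁ ℓ₂ ℓ₃ hℓ₁ hℓ₂ hℓ₃
      h2₁ h2₂ h2₃ hne₁ hne₂ hne₃ hΔ₁ hΔ₂ hΔ₃ hc₁ hc₂ hc₃ r u hi hii hiii
  -- the Tamagawa half in the kernel: `c_q(W/ℚ_q) = c`
  have hcq : ((⟨a1, a2, a3, a4, a6⟩ : WeierstrassCurve ℚ).baseChange ℚ_[q]).localTamagawaNumber ℤ_[q] = c :=
    Additive.IntModelTam.localTamagawaNumber_padic_eq_of_intModel_of_tamLocal hI0 q hTq hT hvals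
  have hI : padicValNat p (AddSubgroup.zmultiples P).index ≤
      padicValNat p (((⟨a1, a2, a3, a4, a6⟩ : WeierstrassCurve ℚ).baseChange ℚ_[q]).localTamagawaNumber
        ℤ_[q]) := by
    rw [hcq]; exact hv.trans hw
  exact Supersingular.bsdp_of_jetchevTamagawaCertificate _ p hKo hJ hGZK hK hD3 hH hopt hP hnt hp2 hpN
    hρ q hqN hI hr hs hvs

/-- **`BSD(E,p)` at a GOOD prime `p ≥ 5` for a literal integer model from the two-engine HEEGNER-INDEX line
through Jetchev 2008 Cor. 1.5, surjectivity / good reduction / Tamagawa exponent IN THE KERNEL — bounded-Kraus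
form.** As `bsdp_of_d1IndexRow_tam_min`, with `IsGloballyMinimal` of the literal model from `Δ ≠ 0`,
`|Δ| < 512¹²` and the bounded Kraus disjunction below `512` (`X11RankOne.isGloballyMinimal_of_krausCriterion_bounded`).
Per pair; no class statement; nothing about any particular curve is asserted.
[cite: Jetchev2008, Hypothesis (*) and Cor. 1.5 (p. 3)] [cite: Serre1972, §2.8 Prop. 19 and §5.2 (iii)]
[cite: SilvermanAEC2009, VII.1 Remark 1.1, VII.5 Prop. 5.1(a) and VIII.8] [cite: SilvermanATAEC1994, IV.9.4 and Thm. II.6.4]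
[cite: GrossLMS1991, §1 Thm. 1.3] [cite: Miller2011LMS, §1 Def. 1.1, Thm. 4.1 and Cor. 4.8] -/
theorem bsdp_of_d1IndexRow_tam (p : ℕ) (hp : p.Prime) (hp5 : 5 ≤ p) (a1 a2 a3 a4 a6 : ℤ)
    (h0 : discOf [a1, a2, a3, a4, a6] ≠ 0) (h512 : (discOf [a1, a2, a3, a4, a6]).natAbs < 512 ^ 12)
    (hKraus : ∀ q < 512, q < 2 ∨ ¬ q ^ 12 ∣ (discOf [a1, a2, a3, a4, a6]).natAbs ∨
      ¬ q ^ 4 ∣ (c4Of [a1, a2, a3, a4, a6]).natAbs ∨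
      (q = 2 ∧ ¬ (2 : ℤ) ^ 8 ∣ c4Of [a1, a2, a3, a4, a6] ∧ (2 : ℤ) ^ 7 ∣ c6Of [a1, a2, a3, a4, a6]) ∨
      (q = 2 ∧ ¬ (2 : ℤ) ^ 24 ∣ discOf [a1, a2, a3, a4, a6] ∧ (512 : ℤ) ∣ c6Of [a1, a2, a3, a4, a6] ∧
        (4 : ℤ) ∣ c6Of [a1, a2, a3, a4, a6] / 512 - 3) ∨
      (q = 3 ∧ (3 : ℤ) ^ 8 ∣ c6Of [a1, a2, a3, a4, a6] ∧ ¬ (3 : ℤ) ^ 9 ∣ c6Of [a1, a2, a3, a4, a6]))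
    (hpΔ : ¬ (p : ℤ) ∣ discOf [a1, a2, a3, a4, a6])
    (ℓ₁ ℓ₂ ℓ₃ : ℕ) (hℓ₁ : ℓ₁.Prime) (hℓ₂ : ℓ₂.Prime) (hℓ₃ : ℓ₃.Prime)
    (h2₁ : ℓ₁ ≠ 2) (h2₂ : ℓ₂ ≠ 2) (h2₃ : ℓ₃ ≠ 2) (hne₁ : ℓ₁ ≠ p) (hne₂ : ℓ₂ ≠ p) (hne₃ : ℓ₃ ≠ p)
    (hΔ₁ : ¬ (ℓ₁ : ℤ) ∣ discOf [a1, a2, a3, a4, a6]) (hΔ₂ : ¬ (ℓ₂ : ℤ) ∣ discOf [a1, a2, a3, a4, a6])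
    (hΔ₃ : ¬ (ℓ₃ : ℤ) ∣ discOf [a1, a2, a3, a4, a6])
    {n₁ n₂ n₃ : ℕ} (hc₁ : countPoints [a1, a2, a3, a4, a6] ℓ₁ = n₁)
    (hc₂ : countPoints [a1, a2, a3, a4, a6] ℓ₂ = n₂) (hc₃ : countPoints [a1, a2, a3, a4, a6] ℓ₃ = n₃)
    (r u : ZMod p)
    (hi : (((ℓ₁ : ℤ) + 1 - n₁ : ℤ) : ZMod p) ^ 2 - 4 * ℓ₁ = r * r ∧
      (((ℓ₁ : ℤ) + 1 - n₁ : ℤ) : ZMod p) ^ 2 - 4 * ℓ₁ ≠ 0 ∧ (((ℓ₁ : ℤ) + 1 - n₁ : ℤ) : ZMod p) ≠ 0)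
    (hii : ((((ℓ₂ : ℤ) + 1 - n₂ : ℤ) : ZMod p) ^ 2 - 4 * ℓ₂) ^ (p / 2) = -1 ∧
      (((ℓ₂ : ℤ) + 1 - n₂ : ℤ) : ZMod p) ≠ 0)
    (hiii : (((ℓ₃ : ℤ) + 1 - n₃ : ℤ) : ZMod p) ^ 2 = u * ℓ₃ ∧
      u ≠ 0 ∧ u ≠ 1 ∧ u ≠ 2 ∧ u ≠ 4 ∧ u ^ 2 - 3 * u + 1 ≠ 0)
    (q : ℕ) (T : TamLocal) (hTq : T.p = q) (hT : T.check ⟨a1, a2, a3, a4, a6⟩ = true)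
    {c : ℕ} (hvals : T.vals = [c]) {w : ℕ} (hw : w ≤ padicValNat p c)
    (hJ : Jetchev2008.cor15_padicValNat_card_primaryComponent_sha_le)
    (hGZK : rank_eq_analyticRank_of_analyticRank_le_one)
    (W : WeierstrassCurve ℚ) (hW : W = ⟨a1, a2, a3, a4, a6⟩)
    {N : ℕ} [NeZero N] {K : Type} [Field K] [NumberField K] (hKo : kolyvagin N W K)
    (hK : IsImaginaryQuadratic K) (hD3 : NumberField.discr K ≠ -3)
    (hH : SatisfiesHeegnerHypothesis N K)
    (hopt : ∃ Dt : ModularParametrizationData W N,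
      ∀ z ∈ Dt.L.lattice, ∃ w ∈ periodLattice Dt.f, z = (Dt.c : ℂ) * w)
    {P : (W.baseChange K).toAffine.Point} (hP : IsHeegnerPoint N W K P) (hnt : ¬ IsOfFinAddOrder P)
    (hqN : q ∣ N) (hv : padicValNat p (AddSubgroup.zmultiples P).index ≤ w)
    (hr : W.analyticRank ≤ 1) {s : ℚ} (hs : shaAn W = (s : ℂ)) (hvs : padicValRat p s = 0) :
    BSDp W p :=
  bsdp_of_d1IndexRow_tam_min p hp hp5 a1 a2 a3 a4 a6
    (isGloballyMinimal_of_krausCriterion_bounded a1 a2 a3 a4 a6 h0 h512 hKraus) hpΔ ℓ₁ ℓ₂ ℓ₃ hℓ₁ hℓ₂ hℓ₃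
    h2₁ h2₂ h2₃ hne₁ hne₂ hne₃ hΔ₁ hΔ₂ hΔ₃ hc₁ hc₂ hc₃ r u hi hii hiii q T hTq hT hvals hw hJ hGZK W hW hKo
    hK hD3 hH hopt hP hnt hqN hv hr hs hvs

/-! ### Unit index line (`p ∤ [E(K):ℤy_K]`): Kolyvagin's unsharpened theorem, no reduction hypothesis at `p` -/

/-- **`BSD(E,p)` at `p ≥ 5` for a literal integer model from the two-engine HEEGNER-INDEX line `p ∤ [E(K):ℤy_K]`
(Kolyvagin 1990 as printed by McCallum 1991 §1 / Gross 1991 Prop. 2.1 (2)), surjectivity of `ρ̄_{E,p}` IN THE KERNEL —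
minimality supplied.** The D1 rows whose Heegner index is prime to `p` (generic when `p ∤ #E(ℚ)_tors·∏c_ℓ·#Ш_an`):
inputs (kernel) `hmin`, THREE Serre witnesses as in `bsdp_of_d1IndexRow_tam_min` (⇒ `ρ̄_{E,p}` onto); (binders,
displayed) Kolyvagin's finiteness `hKo` and prime-by-prime bound `hB : Kolyvagin1990_padicValNat_card_sha_le N W K`
(PUBLISHED; NO hypothesis on the reduction of `E` at `p`), GZK `hGZK`, the Heegner datum (`K`, Heegner hypothesis for
`N`, `P = y_K` of infinite order), the INDEX LINE `hI : ¬ p ∣ [E(K):ℤP]`, `r_an ≤ 1`, `#Ш_an = s` with `ord_p s = 0`.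
Output: the tree's class-agnostic consumer `Typed.bsdp_of_kolyvagin_of_not_dvd_index` — the same road as x11c's
`X4.bsdp_prime_of_kolyvaginIndex_of_serreCounts`, restated in prover B's explicit-witness form (root `r`, Euler's
criterion, `u`) so that both D1 row shapes share ONE witness format. Per pair; no class statement; nothing about any
particular curve is asserted. [cite: McCallumLMS1991, §1 Theorem (Kolyvagin), p. 296] [cite: GrossLMS1991, §2 Prop. 2.1 (2)]
[cite: Serre1972, §2.8 Prop. 19 and §5.2 (iii)] [cite: IrelandRosen1990, Prop. 5.1.2] [cite: Miller2011LMS, §1 Def. 1.1, Thm. 4.1 and Cor. 4.8] -/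
theorem bsdp_of_d1IndexRow_unit_min (p : ℕ) (hp : p.Prime) (hp5 : 5 ≤ p) (a1 a2 a3 a4 a6 : ℤ)
    (hmin : (⟨a1, a2, a3, a4, a6⟩ : WeierstrassCurve ℚ).IsGloballyMinimal)
    (ℓ₁ ℓ₂ ℓ₃ : ℕ) (hℓ₁ : ℓ₁.Prime) (hℓ₂ : ℓ₂.Prime) (hℓ₃ : ℓ₃.Prime)
    (h2₁ : ℓ₁ ≠ 2) (h2₂ : ℓ₂ ≠ 2) (h2₃ : ℓ₃ ≠ 2) (hne₁ : ℓ₁ ≠ p) (hne₂ : ℓ₂ ≠ p) (hne₃ : ℓ₃ ≠ p)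
    (hΔ₁ : ¬ (ℓ₁ : ℤ) ∣ discOf [a1, a2, a3, a4, a6]) (hΔ₂ : ¬ (ℓ₂ : ℤ) ∣ discOf [a1, a2, a3, a4, a6])
    (hΔ₃ : ¬ (ℓ₃ : ℤ) ∣ discOf [a1, a2, a3, a4, a6])
    {n₁ n₂ n₃ : ℕ} (hc₁ : countPoints [a1, a2, a3, a4, a6] ℓ₁ = n₁)
    (hc₂ : countPoints [a1, a2, a3, a4, a6] ℓ₂ = n₂) (hc₃ : countPoints [a1, a2, a3, a4, a6] ℓ₃ = n₃)
    (r u : ZMod p)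
    (hi : (((ℓ₁ : ℤ) + 1 - n₁ : ℤ) : ZMod p) ^ 2 - 4 * ℓ₁ = r * r ∧
      (((ℓ₁ : ℤ) + 1 - n₁ : ℤ) : ZMod p) ^ 2 - 4 * ℓ₁ ≠ 0 ∧ (((ℓ₁ : ℤ) + 1 - n₁ : ℤ) : ZMod p) ≠ 0)
    (hii : ((((ℓ₂ : ℤ) + 1 - n₂ : ℤ) : ZMod p) ^ 2 - 4 * ℓ₂) ^ (p / 2) = -1 ∧
      (((ℓ₂ : ℤ) + 1 - n₂ : ℤ) : ZMod p) ≠ 0)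
    (hiii : (((ℓ₃ : ℤ) + 1 - n₃ : ℤ) : ZMod p) ^ 2 = u * ℓ₃ ∧
      u ≠ 0 ∧ u ≠ 1 ∧ u ≠ 2 ∧ u ≠ 4 ∧ u ^ 2 - 3 * u + 1 ≠ 0)
    (hGZK : rank_eq_analyticRank_of_analyticRank_le_one)
    (W : WeierstrassCurve ℚ) (hW : W = ⟨a1, a2, a3, a4, a6⟩)
    {N : ℕ} [NeZero N] {K : Type} [Field K] [NumberField K] (hKo : kolyvagin N W K)
    (hB : Kolyvagin1990_padicValNat_card_sha_le N W K)
    (hK : IsImaginaryQuadratic K) (hH : SatisfiesHeegnerHypothesis N K)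
    {P : (W.baseChange K).toAffine.Point} (hP : IsHeegnerPoint N W K P) (hnt : ¬ IsOfFinAddOrder P)
    (hI : ¬ p ∣ (AddSubgroup.zmultiples P).index)
    (hr : W.analyticRank ≤ 1) {s : ℚ} (hs : shaAn W = (s : ℂ)) (hvs : padicValRat p s = 0) :
    BSDp W p := by
  subst hW
  have h0 : discOf [a1, a2, a3, a4, a6] ≠ 0 := fun h ↦ hΔ₁ (by rw [h]; exact dvd_zero _)
  haveI hE : (⟨a1, a2, a3, a4, a6⟩ : WeierstrassCurve ℚ).IsElliptic :=
    X11b.isElliptic_of_discOf_ne_zero a1 a2 a3 a4 a6 h0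
  haveI := hmin
  haveI : Fact (Nat.Prime p) := ⟨hp⟩
  have hp2 : p ≠ 2 := by omega
  -- `ρ̄_{E,p}` surjective from the three Serre witnesses (Serre 1972 Prop. 19)
  have hρ : (⟨a1, a2, a3, a4, a6⟩ : WeierstrassCurve ℚ).HasSurjectiveModNGaloisRep p :=
    Supersingular.surj_of_ainvs_of_serreWitnesses a1 a2 a3 a4 a6 p hp5 hmin ℓ₁ ℓ₂ ℓ₃ hℓ₁ hℓ₂ hℓ₃
      h2₁ h2₂ h2₃ hne₁ hne₂ hne₃ hΔ₁ hΔ₂ hΔ₃ hc₁ hc₂ hc₃ r u hi hii hiii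
  exact bsdp_of_kolyvagin_of_not_dvd_index _ p hGZK hKo hB hK hH hP hnt hp2 hρ hI hr hs hvs

/-- **`BSD(E,p)` at `p ≥ 5` for a literal integer model from the HEEGNER-INDEX line `p ∤ [E(K):ℤy_K]`, surjectivity
IN THE KERNEL — bounded-Kraus form** (minimality from `Δ ≠ 0`, `|Δ| < 512¹²` and the bounded Kraus disjunction,
`X11RankOne.isGloballyMinimal_of_krausCriterion_bounded`). As `bsdp_of_d1IndexRow_unit_min`. Per pair; no class
statement. [cite: McCallumLMS1991, §1 Theorem (Kolyvagin), p. 296] [cite: Serre1972, §2.8 Prop. 19 and §5.2 (iii)]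
[cite: SilvermanAEC2009, VII.1 Remark 1.1 and VIII.8] [cite: SilvermanATAEC1994, Thm. II.6.4] [cite: Miller2011LMS, §1 Def. 1.1] -/
theorem bsdp_of_d1IndexRow_unit (p : ℕ) (hp : p.Prime) (hp5 : 5 ≤ p) (a1 a2 a3 a4 a6 : ℤ)
    (h0 : discOf [a1, a2, a3, a4, a6] ≠ 0) (h512 : (discOf [a1, a2, a3, a4, a6]).natAbs < 512 ^ 12)
    (hKraus : ∀ q < 512, q < 2 ∨ ¬ q ^ 12 ∣ (discOf [a1, a2, a3, a4, a6]).natAbs ∨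
      ¬ q ^ 4 ∣ (c4Of [a1, a2, a3, a4, a6]).natAbs ∨
      (q = 2 ∧ ¬ (2 : ℤ) ^ 8 ∣ c4Of [a1, a2, a3, a4, a6] ∧ (2 : ℤ) ^ 7 ∣ c6Of [a1, a2, a3, a4, a6]) ∨
      (q = 2 ∧ ¬ (2 : ℤ) ^ 24 ∣ discOf [a1, a2, a3, a4, a6] ∧ (512 : ℤ) ∣ c6Of [a1, a2, a3, a4, a6] ∧
        (4 : ℤ) ∣ c6Of [a1, a2, a3, a4, a6] / 512 - 3) ∨
      (q = 3 ∧ (3 : ℤ) ^ 8 ∣ c6Of [a1, a2, a3, a4, a6] ∧ ¬ (3 : ℤ) ^ 9 ∣ c6Of [a1, a2, a3, a4, a6]))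
    (ℓ₁ ℓ₂ ℓ₃ : ℕ) (hℓ₁ : ℓ₁.Prime) (hℓ₂ : ℓ₂.Prime) (hℓ₃ : ℓ₃.Prime)
    (h2₁ : ℓ₁ ≠ 2) (h2₂ : ℓ₂ ≠ 2) (h2₃ : ℓ₃ ≠ 2) (hne₁ : ℓ₁ ≠ p) (hne₂ : ℓ₂ ≠ p) (hne₃ : ℓ₃ ≠ p)
    (hΔ₁ : ¬ (ℓ₁ : ℤ) ∣ discOf [a1, a2, a3, a4, a6]) (hΔ₂ : ¬ (ℓ₂ : ℤ) ∣ discOf [a1, a2, a3, a4, a6])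
    (hΔ₃ : ¬ (ℓ₃ : ℤ) ∣ discOf [a1, a2, a3, a4, a6])
    {n₁ n₂ n₃ : ℕ} (hc₁ : countPoints [a1, a2, a3, a4, a6] ℓ₁ = n₁)
    (hc₂ : countPoints [a1, a2, a3, a4, a6] ℓ₂ = n₂) (hc₃ : countPoints [a1, a2, a3, a4, a6] ℓ₃ = n₃)
    (r u : ZMod p)
    (hi : (((ℓ₁ : ℤ) + 1 - n₁ : ℤ) : ZMod p) ^ 2 - 4 * ℓ₁ = r * r ∧
      (((ℓ₁ : ℤ) + 1 - n₁ : ℤ) : ZMod p) ^ 2 - 4 * ℓ₁ ≠ 0 ∧ (((ℓ₁ : ℤ) + 1 - n₁ : ℤ) : ZMod p) ≠ 0)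
    (hii : ((((ℓ₂ : ℤ) + 1 - n₂ : ℤ) : ZMod p) ^ 2 - 4 * ℓ₂) ^ (p / 2) = -1 ∧
      (((ℓ₂ : ℤ) + 1 - n₂ : ℤ) : ZMod p) ≠ 0)
    (hiii : (((ℓ₃ : ℤ) + 1 - n₃ : ℤ) : ZMod p) ^ 2 = u * ℓ₃ ∧
      u ≠ 0 ∧ u ≠ 1 ∧ u ≠ 2 ∧ u ≠ 4 ∧ u ^ 2 - 3 * u + 1 ≠ 0)
    (hGZK : rank_eq_analyticRank_of_analyticRank_le_one)
    (W : WeierstrassCurve ℚ) (hW : W = ⟨a1, a2, a3, a4, a6⟩)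
    {N : ℕ} [NeZero N] {K : Type} [Field K] [NumberField K] (hKo : kolyvagin N W K)
    (hB : Kolyvagin1990_padicValNat_card_sha_le N W K)
    (hK : IsImaginaryQuadratic K) (hH : SatisfiesHeegnerHypothesis N K)
    {P : (W.baseChange K).toAffine.Point} (hP : IsHeegnerPoint N W K P) (hnt : ¬ IsOfFinAddOrder P)
    (hI : ¬ p ∣ (AddSubgroup.zmultiples P).index)
    (hr : W.analyticRank ≤ 1) {s : ℚ} (hs : shaAn W = (s : ℂ)) (hvs : padicValRat p s = 0) :
    BSDp W p :=
  bsdp_of_d1IndexRow_unit_min p hp hp5 a1 a2 a3 a4 a6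
    (isGloballyMinimal_of_krausCriterion_bounded a1 a2 a3 a4 a6 h0 h512 hKraus) ℓ₁ ℓ₂ ℓ₃ hℓ₁ hℓ₂ hℓ₃ h2₁ h2₂
    h2₃ hne₁ hne₂ hne₃ hΔ₁ hΔ₂ hΔ₃ hc₁ hc₂ hc₃ r u hi hii hiii hGZK W hW hKo hB hK hH hP hnt hI hr hs hvs

end Summit.BirchSwinnertonDyer.Rank1Residual.JET

end
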